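import Summits.QuantumAdvantage.QuantumAdvantage.Theorems.CubicForrelationNearExactIsExactEightTypeOWindow
import Summits.QuantumAdvantage.QuantumAdvantage.Theorems.CubicForrelationNearExactIsExactQuadWalshPlateau
import Summits.QuantumAdvantage.QuantumAdvantage.Theorems.CubicForrelationNearExactIsExactDerivDegree
import Summits.QuantumAdvantage.QuantumAdvantage.Theorems.CubicForrelationNearExactIsExactInvariantWeight
import Literature.Computability.QuantumComplexity.SignedCubicForrelation

/-!
# Crux `CubicForrelation.NearExactIsExact` (stmt-QuantumAdvantage-14043) — type E on 8 bits above `13/16`: the SPLIT FLAT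

Certificate seat `b2b-cforr-cert` (generation 2), rung `θ₈ = 13/16`.  HONEST FRAMING: a theorem about cubic Boolean functions on 8 bits
(the finite slice `n = 8` of the crux) — NOT summit progress.

Setting ("type E"): `g : 𝔽₂⁸ → 𝔽₂` cubic with `W_g = 16·v`, `Σ v² = 256`, `256·Φ(f,g) = Σ_x (−1)^{f(x)} v(x)`.  The parity `p = [v odd]` has
degree `≤ 2` (the landed tower, `el_parity_deg`).
* CAPACITY (`el_card_odd_gt`): pointwise `4·(±v) ≤ (2 − [v odd])·v² + 3[v odd]`, so `4·Σ(−1)^f v ≤ 512 + 2N` with `N = #{v odd}`; in the window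
  `Φ > 13/16` this forces `N > 160`.
* DICKSON (`el_card_odd_eq`): `W_p(0) = 256 − 2N ∈ {0, ±2^s}` (the landed `stub_quadWalshPlateau`), so unless every `v` is odd (then `g` is bent),
  `N = 192`.
* THE FLAT (`el_flat_of_quadratic`): a Boolean function of degree `≤ 2` on 8 bits with exactly `64` ones is the indicator of a 6-flat — its
  derivatives are affine (`stub_derivDegree`) of weight `≤ 128`, hence `0` or `128`; double counting `Σ_a wt(D_a) = 2·64·192` leaves exactly `64`
  periods `V₀` (`⊕`-closed), and the `64` ones form one `V₀`-coset.  Applied to `¬p`: `Z := {v even} = x₀ ⊕ V₀` (`el_split_flat`).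
* BUDGET (`el_budget4`): `Σ_x (v − (−1)^f)² = 2⁹(1 − Φ) < 96` in the window.
The companion files derive partner rigidity on `Zᶜ` (`…EightLevelFourPartner`) and the contradiction (`…EightTypeE`).

References: L. E. Dickson, *Linear Groups* (1901) Ch. VIII; C. Carlet, *Boolean Functions for Cryptography and Coding Theory*, CUP 2021, §4.1,
§5.2; S. Aaronson, A. Ambainis, *Forrelation*, SIAM J. Comput. 47 (2018) §1.1.1.  Everything below is proved from Mathlib and the tree; axioms are
the standard three.
-/

set_option linter.dupNamespace false -- D-0017: single-problem summit ⇒ `QuantumAdvantage.QuantumAdvantage` by design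

noncomputable section

namespace Summit.QuantumAdvantage.QuantumAdvantage.Theorems.CubicForrelation.NearExactIsExact

open Finset
open Literature.Computability.QuantumComplexity
open Literature.Computability.QuantumComplexity.BuzetChailloux (bxor zeroVec bxor_bxor_cancel_left twist_zeroVec_right bxor_zeroVec
  zeroVec_bxor signOf_sq)
open Literature.Computability.QuantumComplexity.DerivativeWalsh (W)

/-! ### Parity, energy, forrelation at level 4 -/

/-- In type E (`W_g = 16v`, `g` cubic on 8 bits) the parity `[v odd]` has algebraic degree `≤ 2` (the landed tower). [cite: Carlet2020, §4.1] -/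
theorem el_parity_deg (g : (Fin (4 + 4) → Bool) → Bool) (v : (Fin (4 + 4) → Bool) → ℤ) (hg : IsDegLeFun 3 g)
    (hv : ∀ x, W (fun y => signOf (g y)) x = (2 : ℝ) ^ 4 * (v x : ℝ)) : IsDegLeFun 2 (fun x => decide (Odd (v x))) :=
  stub_walshTower stub_axParity (4 + 4) 4 2 g v hg hv (by intro k hk hkn; omega)

/-- Energy at level 4: `Σ v² = 256`. [folklore] -/
theorem el_sum_sq (g : (Fin (4 + 4) → Bool) → Bool) (v : (Fin (4 + 4) → Bool) → ℤ)
    (hv : ∀ x, W (fun y => signOf (g y)) x = (2 : ℝ) ^ 4 * (v x : ℝ)) : ∑ x, (v x) ^ 2 = (256 : ℤ) := by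
  have hP := eow_parseval g
  simp_rw [hv] at hP
  have h : ((∑ x, (v x) ^ 2 : ℤ) : ℝ) = 256 := by
    push_cast
    have e : ∀ x, ((2 : ℝ) ^ 4 * (v x : ℝ)) ^ 2 = 256 * ((v x : ℝ) ^ 2) := fun x => by ring
    rw [sum_congr rfl fun x _ => e x, ← mul_sum] at hP
    nlinarith
  exact_mod_cast h

/-- Forrelation at level 4: `256·Φ(f,g) = Σ_x (−1)^{f(x)} v(x)`. [cite: AaronsonAmbainis2018, §1.1.1] -/
theorem el_forrelation (f g : (Fin (4 + 4) → Bool) → Bool) (v : (Fin (4 + 4) → Bool) → ℤ)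
    (hv : ∀ x, W (fun y => signOf (g y)) x = (2 : ℝ) ^ 4 * (v x : ℝ)) :
    256 * forrelation f g = ((∑ x, sZ (f x) * v x : ℤ) : ℝ) := by
  have hΦ := vg_two_pow_mul_forrelation f g
  simp_rw [hv] at hΦ
  push_cast
  simp_rw [tp_sZ_cast]
  have e : ∀ x, signOf (f x) * ((2 : ℝ) ^ 4 * (v x : ℝ)) = 16 * (signOf (f x) * v x) := fun x => by ring
  rw [sum_congr rfl fun x _ => e x, ← mul_sum, show (2 : ℝ) ^ (3 * 4) = 4096 by norm_num] at hΦ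
  linarith

/-! ### Capacity: the window forces many odd values -/

/-- Pointwise capacity bound: for `s = ±1`, `4sv ≤ (2 − [v odd])v² + 3[v odd]` and `[v odd] ≤ [v odd]·v²`. [this work] -/
theorem el_pt_bound (v s : ℤ) (hs : s = 1 ∨ s = -1) :
    4 * (s * v) + (if Odd v then (1 : ℤ) else 0) * v ^ 2 ≤ 2 * v ^ 2 + 3 * (if Odd v then (1 : ℤ) else 0) ∧
    (if Odd v then (1 : ℤ) else 0) ≤ (if Odd v then (1 : ℤ) else 0) * v ^ 2 := by
  by_cases ho : Odd v
  · have h1 := Int.odd_iff.1 ho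
    have hv : v ≤ -3 ∨ v = -1 ∨ v = 1 ∨ 3 ≤ v := by omega
    rw [if_pos ho]
    constructor
    · rcases hs with rfl | rfl <;> rcases hv with h | rfl | rfl | h <;> nlinarith
    · rcases hv with h | rfl | rfl | h <;> nlinarith
  · have h1 : v % 2 = 0 := Int.even_iff.1 (Int.not_odd_iff_even.1 ho)
    have hv : v ≤ -2 ∨ v = 0 ∨ 2 ≤ v := by omega
    rw [if_neg ho]
    constructor
    · rcases hs with rfl | rfl <;> rcases hv with h | rfl | h <;> nlinarith
    · simp

/-- **Capacity.** In type E with `Φ(f,g) > 13/16`, more than `160` values of `v` are odd. [this work] -/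
theorem el_card_odd_gt (f g : (Fin (4 + 4) → Bool) → Bool) (v : (Fin (4 + 4) → Bool) → ℤ)
    (hv : ∀ x, W (fun y => signOf (g y)) x = (2 : ℝ) ^ 4 * (v x : ℝ)) (hΦ : 13 / 16 < forrelation f g) :
    160 < #(univ.filter fun x => Odd (v x)) := by
  have hE := el_sum_sq g v hv
  have hF := el_forrelation f g v hv
  have h208 : (208 : ℤ) < ∑ x, sZ (f x) * v x := by
    have : (208 : ℝ) < ((∑ x, sZ (f x) * v x : ℤ) : ℝ) := by rw [← hF]; linarith
    exact_mod_cast this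
  have hpt := fun x => el_pt_bound (v x) (sZ (f x)) (tp_sZ_cases (f x))
  have h1 := sum_le_sum fun x (_ : x ∈ (univ : Finset (Fin (4 + 4) → Bool))) => (hpt x).1
  have h2 := sum_le_sum fun x (_ : x ∈ (univ : Finset (Fin (4 + 4) → Bool))) => (hpt x).2
  rw [sum_add_distrib, ← mul_sum] at h1
  rw [sum_add_distrib, ← mul_sum, ← mul_sum, hE] at h1
  have hN : ∑ x, (if Odd (v x) then (1 : ℤ) else 0) = #(univ.filter fun x => Odd (v x)) := by
    rw [sum_boole]
  rw [hN] at h1 h2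
  have : (160 : ℤ) < #(univ.filter fun x => Odd (v x)) := by linarith
  exact_mod_cast this

/-! ### Dickson: exactly `192` odd values -/

/-- Arithmetic of the plateau at `y = 0`: `160 < N < 256` and `256 − 2N ∈ {0} ∪ {t : t² = 4^s}` force `N = 192`. [folklore] -/
theorem el_nat_helper (N s : ℕ) (h160 : 160 < N) (h256 : N < 256)
    (h : (256 : ℝ) - 2 * N = 0 ∨ ((256 : ℝ) - 2 * N) ^ 2 = (4 : ℝ) ^ s) : N = 192 := by
  rcases h with h | h
  · have : (256 : ℝ) = 2 * N := by linarith
    have : (256 : ℕ) = 2 * N := by exact_mod_cast this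
    omega
  · have hc : ((256 : ℝ) - 2 * N) ^ 2 = (((2 * N - 256 : ℕ)) : ℝ) ^ 2 := by
      rw [Nat.cast_sub (by omega)]; push_cast; ring
    have h4 : (4 : ℕ) ^ s = (2 ^ s) ^ 2 := by rw [← pow_mul, mul_comm, pow_mul]; norm_num
    have hM : (2 * N - 256) ^ 2 = (2 ^ s) ^ 2 := by
      rw [← h4]; exact_mod_cast hc.symm.trans h
    have hM' : 2 * N - 256 = 2 ^ s := Nat.pow_left_injective (by norm_num) hM
    rcases Nat.lt_or_ge s 7 with h7 | h7
    · have : 2 ^ s ≤ 2 ^ 6 := Nat.pow_le_pow_right (by norm_num) (by omega)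
      omega
    · rcases Nat.lt_or_ge s 8 with h8 | h8
      · have hs7 : s = 7 := by omega
        subst hs7; omega
      · have : 2 ^ 8 ≤ 2 ^ s := Nat.pow_le_pow_right (by norm_num) h8
        omega

/-- **`N = 192`.** In type E with `Φ > 13/16`, if some value of `v` is even then exactly `192` values are odd (the parity `[v odd]` is a
quadratic of weight `> 160` and `< 256`, and `256 − 2N ∈ {0, ±2^s}`). [this work] -/
theorem el_card_odd_eq (f g : (Fin (4 + 4) → Bool) → Bool) (hg : IsDegLeFun 3 g) (v : (Fin (4 + 4) → Bool) → ℤ)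
    (hv : ∀ x, W (fun y => signOf (g y)) x = (2 : ℝ) ^ 4 * (v x : ℝ)) (hΦ : 13 / 16 < forrelation f g)
    (hne : ∃ x, ¬ Odd (v x)) : #(univ.filter fun x => Odd (v x)) = 192 := by
  have hgt := el_card_odd_gt f g v hv hΦ
  have hlt : #(univ.filter fun x => Odd (v x)) < 256 := by
    obtain ⟨x, hx⟩ := hne
    calc #(univ.filter fun x => Odd (v x)) < #(univ : Finset (Fin (4 + 4) → Bool)) :=
          card_lt_card ⟨filter_subset _ _, fun h => hx (mem_filter.1 (h (mem_univ x))).2⟩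
      _ = 256 := by simp
  obtain ⟨s, hs⟩ := stub_quadWalshPlateau (4 + 4) (fun x => decide (Odd (v x))) (el_parity_deg g v hg hv)
  have hW0 : W (fun x => signOf (decide (Odd (v x)))) zeroVec = 256 - 2 * (#(univ.filter fun x => Odd (v x)) : ℝ) := by
    have e : W (fun x => signOf (decide (Odd (v x)))) zeroVec = ∑ x, signOf (decide (Odd (v x))) := by
      show (∑ x, signOf (decide (Odd (v x))) * twist x zeroVec) = _
      exact sum_congr rfl fun x _ => by rw [twist_zeroVec_right, mul_one]
    rw [e, fc_sum_signOf_eq_card]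
    have hf : (univ.filter fun x : Fin (4 + 4) → Bool => decide (Odd (v x)) = true) = univ.filter fun x => Odd (v x) :=
      filter_congr fun x _ => by simp
    rw [hf]
    norm_num
  exact el_nat_helper _ s hgt hlt (by
    rcases hs zeroVec with h0 | h0 <;> rw [hW0] at h0
    · exact Or.inl h0
    · exact Or.inr h0)

/-! ### A quadratic with `64` ones is the indicator of a 6-flat -/

/-- The number of ones of an affine Boolean function on 8 bits is `0`, `128` or `256`. [cite: Carlet2020, §4.1] -/
theorem el_card_affine (h : (Fin (4 + 4) → Bool) → Bool) (hh : IsDegLeFun 1 h) :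
    #(univ.filter fun x => h x = true) = 0 ∨ #(univ.filter fun x => h x = true) = 128 ∨ #(univ.filter fun x => h x = true) = 256 := by
  obtain ⟨z, hz⟩ := td_count_cube (le_refl 1) h hh univ
  simp only [mem_univ, implies_true, true_and, card_univ, Fintype.card_fin, show (4 + 4 + 1 - 1) / 1 = 8 by norm_num] at hz
  have hle : #(univ.filter fun x => h x = true) ≤ 256 := by
    calc #(univ.filter fun x => h x = true) ≤ #(univ : Finset (Fin (4 + 4) → Bool)) := card_le_univ _
      _ = 256 := by simp
  omega

/-- **A quadratic with `64` ones is a 6-flat.** If `q : 𝔽₂⁸ → 𝔽₂` has degree `≤ 2` and exactly `64` ones, then its set of periods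
`V₀ = {a : q(x ⊕ a) = q(x) ∀x}` is `⊕`-closed of size `64` and the ones of `q` form a single coset of `V₀`. [this work] -/
theorem el_flat_of_quadratic (q : (Fin (4 + 4) → Bool) → Bool) (hq : IsDegLeFun 2 q) (h64 : #(univ.filter fun x => q x = true) = 64) :
    zeroVec ∈ (univ.filter fun a : Fin (4 + 4) → Bool => ∀ x, q (bxor x a) = q x) ∧
    (∀ a ∈ (univ.filter fun a : Fin (4 + 4) → Bool => ∀ x, q (bxor x a) = q x),
      ∀ b ∈ (univ.filter fun a : Fin (4 + 4) → Bool => ∀ x, q (bxor x a) = q x),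
        bxor a b ∈ (univ.filter fun a : Fin (4 + 4) → Bool => ∀ x, q (bxor x a) = q x)) ∧
    #(univ.filter fun a : Fin (4 + 4) → Bool => ∀ x, q (bxor x a) = q x) = 64 ∧
    ∀ x₀, q x₀ = true → (univ.filter fun x => q x = true) =
      (univ.filter fun a : Fin (4 + 4) → Bool => ∀ x, q (bxor x a) = q x).image (bxor x₀) := by
  classical
  set V₀ := univ.filter (fun a : Fin (4 + 4) → Bool => ∀ x, q (bxor x a) = q x) with hV₀
  have h0 : zeroVec ∈ V₀ := mem_filter.2 ⟨mem_univ _, fun x => by rw [bxor_zeroVec]⟩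
  have hadd : ∀ a ∈ V₀, ∀ b ∈ V₀, bxor a b ∈ V₀ := by
    intro a ha b hb
    refine mem_filter.2 ⟨mem_univ _, fun x => ?_⟩
    rw [← iw_bxor_assoc, (mem_filter.1 hb).2, (mem_filter.1 ha).2]
  -- weight of a derivative: 0 or 128
  have hD : ∀ a, #(univ.filter fun x => (q x ^^ q (bxor x a)) = true) = 0 ∨
      #(univ.filter fun x => (q x ^^ q (bxor x a)) = true) = 128 := by
    intro a
    have haff : IsDegLeFun 1 (fun x => q x ^^ q (bxor x a)) := stub_derivDegree (4 + 4) 1 q a hq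
    have hle : #(univ.filter fun x => (q x ^^ q (bxor x a)) = true) ≤ 128 := by
      calc #(univ.filter fun x => (q x ^^ q (bxor x a)) = true)
          ≤ #((univ.filter fun x => q x = true) ∪ univ.filter fun x => q (bxor x a) = true) := by
            refine card_le_card fun x hx => ?_
            have h' := (mem_filter.1 hx).2
            rw [mem_union, mem_filter, mem_filter]
            revert h'; cases q x <;> cases q (bxor x a) <;> simp
        _ ≤ #(univ.filter fun x => q x = true) + #(univ.filter fun x => q (bxor x a) = true) := card_union_le _ _
        _ = 64 + 64 := by
            rw [h64]
            congr 1
            rw [← h64]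
            refine card_nbij' (fun x => bxor x a) (fun x => bxor x a) (fun x hx => ?_) (fun x hx => ?_)
              (fun x _ => by show bxor (bxor x a) a = x; rw [iw_bxor_assoc, BuzetChailloux.bxor_self, bxor_zeroVec])
              (fun x _ => by show bxor (bxor x a) a = x; rw [iw_bxor_assoc, BuzetChailloux.bxor_self, bxor_zeroVec])
            · exact mem_filter.2 ⟨mem_univ _, (mem_filter.1 hx).2⟩
            · refine mem_filter.2 ⟨mem_univ _, ?_⟩
              rw [iw_bxor_assoc, BuzetChailloux.bxor_self, bxor_zeroVec]; exact (mem_filter.1 hx).2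
    rcases el_card_affine _ haff with h | h | h
    · exact Or.inl h
    · exact Or.inr h
    · omega
  have hmemV : ∀ a, a ∈ V₀ ↔ #(univ.filter fun x => (q x ^^ q (bxor x a)) = true) = 0 := by
    intro a
    rw [card_eq_zero, filter_eq_empty_iff]
    constructor
    · intro ha x _; rw [(mem_filter.1 ha).2 x, Bool.xor_self]; exact Bool.false_ne_true
    · intro h0; refine mem_filter.2 ⟨mem_univ _, fun x => ?_⟩
      have := h0 (mem_univ x); revert this; cases q x <;> cases q (bxor x a) <;> simp
  -- double counting
  have hcount : ∑ a, (#(univ.filter fun x => (q x ^^ q (bxor x a)) = true) : ℕ) = 24576 := by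
    simp_rw [card_filter]
    rw [sum_comm]
    have inner : ∀ x, ∑ a, (if (q x ^^ q (bxor x a)) = true then 1 else 0 : ℕ) = if q x = true then 192 else 64 := by
      intro x
      rw [Fintype.sum_equiv (Equiv.mk (bxor x) (bxor x) (bxor_bxor_cancel_left x) (bxor_bxor_cancel_left x))
        (fun a => if (q x ^^ q (bxor x a)) = true then 1 else 0) (fun y => if (q x ^^ q y) = true then 1 else 0) (fun _ => rfl)]
      rw [sum_boole]
      cases hx : q x
      · simp only [Bool.false_xor, Bool.false_eq_true, if_false]
        exact h64
      · simp only [Bool.true_xor, if_true, Bool.not_eq_true', Nat.cast_id]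
        have hc := card_filter_add_card_filter_not (s := (univ : Finset (Fin (4 + 4) → Bool))) (fun y => q y = true)
        rw [h64, card_univ, Fintype.card_fun, Fintype.card_bool, Fintype.card_fin] at hc
        simp only [Nat.reducePow, Nat.reduceAdd] at hc
        have h192 : #(univ.filter fun y : Fin (4 + 4) → Bool => ¬ q y = true) = 192 := Nat.add_left_cancel (hc.trans (by norm_num))
        have hc' : (univ.filter fun y : Fin (4 + 4) → Bool => ¬ q y = true) = univ.filter fun y => q y = false :=
          filter_congr fun y _ => by cases q y <;> simp
        rw [← hc']; exact h192
    rw [sum_congr rfl fun x _ => inner x, sum_ite, sum_const, sum_const, smul_eq_mul, smul_eq_mul]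
    have hc : #(univ.filter fun x : Fin (4 + 4) → Bool => ¬ q x = true) = 192 := by
      have := card_filter_add_card_filter_not (s := (univ : Finset (Fin (4 + 4) → Bool))) (fun x => q x = true)
      rw [h64, card_univ, Fintype.card_fun, Fintype.card_bool, Fintype.card_fin] at this
      simp only [Nat.reducePow, Nat.reduceAdd] at this
      exact Nat.add_left_cancel (this.trans (by norm_num))
    rw [h64, hc]
  have hcount' : ∑ a, (#(univ.filter fun x => (q x ^^ q (bxor x a)) = true) : ℕ) = 128 * #(univ.filter fun a => a ∉ V₀) := by
    rw [← sum_filter_add_sum_filter_not univ (fun a => a ∈ V₀)]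
    rw [sum_eq_zero fun a ha => (hmemV a).1 (mem_filter.1 ha).2, zero_add]
    rw [sum_congr rfl fun a ha => ((hD a).resolve_left fun h => absurd ((hmemV a).2 h) (mem_filter.1 ha).2), sum_const,
      smul_eq_mul, mul_comm]
  have hcardV : #V₀ = 64 := by
    have h1 : #(univ.filter fun a : Fin (4 + 4) → Bool => a ∉ V₀) = 192 := by
      have := hcount.symm.trans hcount'; omega
    have h2 := card_filter_add_card_filter_not (s := (univ : Finset (Fin (4 + 4) → Bool))) (fun a => a ∈ V₀)
    rw [h1, filter_mem_eq_inter, univ_inter, card_univ, Fintype.card_fun, Fintype.card_bool, Fintype.card_fin] at h2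
    simp only [Nat.reducePow, Nat.reduceAdd] at h2
    omega
  refine ⟨h0, hadd, hcardV, fun x₀ hx₀ => ?_⟩
  symm
  apply eq_of_subset_of_card_le
  · intro y hy
    obtain ⟨a, ha, rfl⟩ := mem_image.1 hy
    exact mem_filter.2 ⟨mem_univ _, by rw [(mem_filter.1 ha).2 x₀]; exact hx₀⟩
  · rw [h64, card_image_of_injective _ fun a b hab => by simpa only [bxor_bxor_cancel_left] using congrArg (bxor x₀) hab,
      hcardV]

/-! ### The split flat and the budget at level 4 -/

/-- **The budget at level 4.** With `W_g = 16v` and `s = (−1)^f`: `Σ_x (v − s)² = 2⁹(1 − Φ(f,g))`; in the window `Φ > 13/16` it is `< 96`.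
[this work] -/
theorem el_budget4 (f g : (Fin (4 + 4) → Bool) → Bool) (v : (Fin (4 + 4) → Bool) → ℤ)
    (hv : ∀ x, W (fun y => signOf (g y)) x = (2 : ℝ) ^ 4 * (v x : ℝ)) (hΦ : 13 / 16 < forrelation f g) :
    (∑ x, (v x - sZ (f x)) ^ 2 : ℤ) < 96 := by
  have hu : ∀ x, W (fun y => signOf (g y)) x = (2 : ℝ) ^ 3 * ((2 * v x : ℤ) : ℝ) := by
    intro x; rw [hv x]; push_cast; ring
  have hB := eow_budget f g (fun x => 2 * v x) hu
  have e : ∀ x, (2 * v x - 2 * sZ (f x)) ^ 2 = 4 * (v x - sZ (f x)) ^ 2 := fun x => by ring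
  simp only [e] at hB
  rw [← mul_sum] at hB
  push_cast at hB
  have : ((∑ x, (v x - sZ (f x)) ^ 2 : ℤ) : ℝ) < 96 := by push_cast; nlinarith
  exact_mod_cast this

end Summit.QuantumAdvantage.QuantumAdvantage.Theorems.CubicForrelation.NearExactIsExact

end
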